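import Summits.QuantumFields.BalabanUV.T4Continuum.Support.ShellMeasureLinearizedGammaTSharp
import Summits.QuantumFields.BalabanUV.T4Continuum.Support.ShellMeasureLinearizedWindowNumbers

/-!
# `T4Continuum.ShellMeasureLinearizedWindowNumbersSharp` — NE7c-S100 f4 «γ9″ THE SHARP W-d WINDOW»: S97's WINDOW NUMBERS
# RE-RUN AT THE SHARP PAIR `(R♯, M♯) = (1∕(16(d+1)L), ½)` of S100 f2 — `εw♯ ≤ R♯²∕(9·L^{d−1})`, plug∕slot radius
# `r ≤ R♯²∕(18·L^{d−1}) = 1∕(4608(d+1)²L^{d+1})`; on `T⁴`: `r ≤ 1∕(115 200·L⁵)`, i.e. `≤ 1∕3 686 400 ≈ 2.7·10⁻⁷` at `L = 2`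
# (S97: `≈ 4.4·10⁻¹²`; gain `2·176² = 61 952`)
(cell `pub-balaban`, sub-cell `t4`, spine estimate NE7c (node U5b); NE7c ROUND-2 crew, seat
`b2b-balaban-t4-ne7c-formalise-leaf-05` gen 10; row S100 (owner ruling R-ne7cp1-g35-1 (c): f1∕f2 leaf-06-g8, f3∕f4 this
seat); imports f3 `ShellMeasureLinearizedGammaTSharp` (`window_ok_M`; the ENDs at any certified pair) and S97
`ShellMeasureLinearizedWindowNumbers` (`b_ge`, `pow_div_eq`) ONLY — pure real arithmetic about the pair `(1∕(16(d+1)L), ½)`,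
NO dependency on S100 f1∕f2's bytes (the pair is CERTIFIED by f2 `ShellMeasureAverageAnalyticB7Sharp`, leaf-06-g8, and
plugged into f3's ENDs + S91 f3's plug in f5 `ShellMeasureLinearizedEndGammaTSharp`); [folklore]; 0 `def`, 0 `def … : Prop`,
0 sorry, 0 citations)

HONEST FRAMING.  Finite four-torus programme, rung (B)+1 only — NOT infinite volume, NOT a mass gap, NOT the Clay
problem, NOT summit progress; (B), `BetaPertHyp`, (B^μ) not consumed.  NE7c (`T4IndicatorShell.ShellWeightBound`) is
NOT PRINTED and NOT PROVED; «NE7c ⇐ the named binders».  THIS FILE IS KERNEL PLUMBING + A CENSUS OF OUR OWN CONSTANTS: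
the numbers below are artefacts of OUR bounds (S100 f1∕f2's telescoping Lipschitz words in place of S49's Schwarz-at-0
steps; S46's Cauchy onset `Mq R M = 2M∕R²`); [Balaban1987RG1] p. 267 prints NO number; nothing printed is asserted,
quantified or disputed.  WHAT MOVES: WALL §2b row `S` ∕ COUPLING paragraph's «one explicit ceiling, ours, W-d plug road
only» — from `≈ 4.4·10⁻¹²` (S97) to `≈ 2.7·10⁻⁷` at `d = 4`, `L = 2` (still of TYPE «`ε_j = g_j p₀(g_j)` small», K-uniform,
η-free, volume-free); S49∕S52∕S60∕S91∕S97 untouched (twins); the END-II-final of record and THE ONE CALL unaffected.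
NOTHING in the countdown moves; spine PROVED 0∕9.  HONEST DEPENDENCY (cell, verbatim): continuum YM on T⁴ ⇐ BetaPertH ∧
nine spine estimates (0/9 proved); BetaPertH ⇐ (D1) ∧ (D4) ∧ CAP+tail; G-an2-4 gates asym, D1 and NE2/3/4.

CONTENT.
* §2 the plug's window condition at `M_Q = ½` as a radius bound: `Mq R ½ = 1∕R²`, `9·Mq R ½·b·r ≤ ½ ⇔ r ≤ R²∕(18b)`;
  **`slotRadius_le_sharp(_explicit)`**: `r ≤ R♯²∕(18·(Lᵈ∕L)) = 1∕(4608(d+1)²L²·(Lᵈ∕L))`.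
* §3 on `T⁴`: **`slotRadius_le_sharp_T4`** `r ≤ 1∕(115 200·L⁵)`; `_L2`: `≤ 1∕3 686 400 < 2.72·10⁻⁷`; `_L3`:
  `≤ 1∕27 993 600 < 3.58·10⁻⁸`.
* §4 non-vacuity: `εw♯ = R²∕(9b + 3R + 1)` (f5's `_local_sharp_explicit` window) meets the `< 1` window form (f3
  `window_ok_M` at `½`) and is positive.
* §5 the END's own window `εw♯ ≤ R♯²∕(9·(Lᵈ∕L))`; `< 5.43·10⁻⁷` on `T⁴` at `L = 2`.
* §6 DECIMALS for WALL §2b row `S`: `R♯`, `Mq R♯ ½`, `εw♯(ε = 0)` at `d = 4`, `L = 2, 3`, and the gains over S97.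
TWO ENGINES: kernel `norm_num` below; exact rationals (python `fractions`) on the journal PROPOSED line —
`(1∕160)²∕(9·8 + 3∕160 + 1) = 1∕1 869 280`, `(1∕160)²∕(18·8) = 1∕3 686 400`, `(1∕240)²∕(9·27 + 3∕240 + 1) = 1∕14 055 120`,
`(1∕240)²∕(18·27) = 1∕27 993 600`, `228 379 852 800∕3 686 400 = 61 952 = 2·176²`, `114 982 996 480∕1 869 280 = 61 511.9…`.
-/

noncomputable section

open Set Metric

namespace Summit.QuantumFields.BalabanUV.T4Continuum.ShellMeasureLinearizedWindowNumbersSharp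

open Summit.QuantumFields.BalabanUV.Beta.LinearizingChange267FromQ (Mq)
open ShellMeasureLinearizedGammaTSharp (window_ok_M)
open ShellMeasureLinearizedWindowNumbers (b_ge pow_div_eq)

/-! ## §2 The plug's window condition at `M_Q = ½` as a radius bound -/

/-- `Mq R ½ = 1∕R²`. [folklore] -/
theorem Mq_half (R : ℝ) : Mq R (1 / 2) = 1 / R ^ 2 := by unfold Mq; ring

/-- **THE PLUG's WINDOW CONDITION AT `M_Q = ½` IS A RADIUS BOUND**: `9·Mq R ½·b·r ≤ ½ ⇔ r ≤ R²∕(18b)` (`R, b > 0`).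
[folklore] -/
theorem hq2_iff_half {R b r : ℝ} (hR : 0 < R) (hb : 0 < b) :
    9 * Mq R (1 / 2) * b * r ≤ 1 / 2 ↔ r ≤ R ^ 2 / (18 * b) := by
  have hR2 : 0 < R ^ 2 := by positivity
  have key : 9 * Mq R (1 / 2) * b * r = (r * (18 * b)) / R ^ 2 / 2 := by rw [Mq_half]; field_simp; ring
  rw [key, le_div_iff₀ (by positivity : (0 : ℝ) < 18 * b), div_le_iff₀ (by norm_num : (0 : ℝ) < 2),
    div_le_iff₀ hR2]
  constructor <;> intro h <;> linarith

/-- **THE PLUG's WINDOW PARAMETER AT THE SHARP PAIR** (S60∕S91 f3's `hq2` at `(R♯, ½)`; every slot radius `< εw` obeys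
the same bound): under the budget and `0 ≤ ε`, `r ≤ R♯²∕(18·(Lᵈ∕L))`, `R♯ = 1∕(16(d+1)L)`. [folklore] -/
theorem slotRadius_le_sharp {L d : ℕ} (hL : 0 < L) {ε r : ℝ} (hε : 0 ≤ ε) (hbud : (L : ℝ) ^ d / L * (24 * ε) < 1)
    (hq2 : 9 * Mq (1 / (16 * ((d : ℝ) + 1) * L)) (1 / 2) *
      (((L : ℝ) ^ d / L) / (1 - (L : ℝ) ^ d / L * (24 * ε))) * r ≤ 1 / 2) :
    r ≤ (1 / (16 * ((d : ℝ) + 1) * L)) ^ 2 / (18 * ((L : ℝ) ^ d / L)) := by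
  have hLr : (0 : ℝ) < L := by exact_mod_cast hL
  have hR : (0 : ℝ) < 1 / (16 * ((d : ℝ) + 1) * L) := by positivity
  have ha : 0 < (L : ℝ) ^ d / L := by positivity
  have hbge := b_ge (d := d) hL hε hbud
  have hb : 0 < ((L : ℝ) ^ d / L) / (1 - (L : ℝ) ^ d / L * (24 * ε)) := lt_of_lt_of_le ha hbge
  have h := (hq2_iff_half hR hb).1 hq2
  exact h.trans (div_le_div_of_nonneg_left (by positivity) (by positivity) (by nlinarith))

/-- … explicitly: `r ≤ 1∕(4608·(d+1)²·L²·(Lᵈ∕L))` (`18·16² = 4608`). [folklore] -/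
theorem slotRadius_le_sharp_explicit {L d : ℕ} (hL : 0 < L) {ε r : ℝ} (hε : 0 ≤ ε)
    (hbud : (L : ℝ) ^ d / L * (24 * ε) < 1)
    (hq2 : 9 * Mq (1 / (16 * ((d : ℝ) + 1) * L)) (1 / 2) *
      (((L : ℝ) ^ d / L) / (1 - (L : ℝ) ^ d / L * (24 * ε))) * r ≤ 1 / 2) :
    r ≤ 1 / (4608 * ((d : ℝ) + 1) ^ 2 * (L : ℝ) ^ 2 * ((L : ℝ) ^ d / L)) := by
  have hLr : (0 : ℝ) < L := by exact_mod_cast hL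
  refine (slotRadius_le_sharp hL hε hbud hq2).trans (le_of_eq ?_)
  field_simp
  norm_num

/-! ## §3 On `T⁴`: `r ≤ 1∕(115 200·L⁵)`; `≤ 1∕3 686 400 < 2.72·10⁻⁷` at `L = 2`, `≤ 1∕27 993 600 < 3.58·10⁻⁸` at `L = 3` -/

/-- **ON `T⁴` (`d = 4`)**: the plug's window parameter (hence every slot radius) is `≤ 1∕(115 200·L⁵)`
(`4608·25 = 115 200`; S97: `1∕(7 136 870 400·L⁵)`, ratio `61 952 = 2·176²`). [folklore] -/
theorem slotRadius_le_sharp_T4 {L : ℕ} (hL : 0 < L) {ε r : ℝ} (hε : 0 ≤ ε) (hbud : (L : ℝ) ^ 4 / L * (24 * ε) < 1)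
    (hq2 : 9 * Mq (1 / (16 * ((4 : ℕ) + 1 : ℝ) * L)) (1 / 2) *
      (((L : ℝ) ^ 4 / L) / (1 - (L : ℝ) ^ 4 / L * (24 * ε))) * r ≤ 1 / 2) :
    r ≤ 1 / (115200 * (L : ℝ) ^ 5) := by
  have h := slotRadius_le_sharp_explicit (d := 4) hL hε hbud hq2
  have e : (4608 : ℝ) * ((4 : ℕ) + 1 : ℝ) ^ 2 * (L : ℝ) ^ 2 * ((L : ℝ) ^ (4 - 1)) = 115200 * (L : ℝ) ^ 5 := by
    push_cast; ring
  rwa [pow_div_eq hL (by norm_num), e] at h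

/-- **AT `L = 2`**: `r ≤ 1∕3 686 400 < 2.72·10⁻⁷` (S97: `< 5·10⁻¹²`). [folklore] -/
theorem slotRadius_lt_sharp_L2 {ε r : ℝ} (hε : 0 ≤ ε) (hbud : ((2 : ℕ) : ℝ) ^ 4 / (2 : ℕ) * (24 * ε) < 1)
    (hq2 : 9 * Mq (1 / (16 * ((4 : ℕ) + 1 : ℝ) * (2 : ℕ))) (1 / 2) *
      ((((2 : ℕ) : ℝ) ^ 4 / (2 : ℕ)) / (1 - ((2 : ℕ) : ℝ) ^ 4 / (2 : ℕ) * (24 * ε))) * r ≤ 1 / 2) :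
    r ≤ 1 / 3686400 ∧ r < 272 / 10 ^ 9 := by
  have h := slotRadius_le_sharp_T4 (L := 2) (by norm_num) hε hbud hq2
  exact ⟨h.trans (by norm_num), h.trans_lt (by norm_num)⟩

/-- **AT `L = 3`**: `r ≤ 1∕27 993 600 < 3.58·10⁻⁸` (S97: `< 6·10⁻¹³`). [folklore] -/
theorem slotRadius_lt_sharp_L3 {ε r : ℝ} (hε : 0 ≤ ε) (hbud : ((3 : ℕ) : ℝ) ^ 4 / (3 : ℕ) * (24 * ε) < 1)
    (hq2 : 9 * Mq (1 / (16 * ((4 : ℕ) + 1 : ℝ) * (3 : ℕ))) (1 / 2) *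
      ((((3 : ℕ) : ℝ) ^ 4 / (3 : ℕ)) / (1 - ((3 : ℕ) : ℝ) ^ 4 / (3 : ℕ) * (24 * ε))) * r ≤ 1 / 2) :
    r ≤ 1 / 27993600 ∧ r < 358 / 10 ^ 10 := by
  have h := slotRadius_le_sharp_T4 (L := 3) (by norm_num) hε hbud hq2
  exact ⟨h.trans (by norm_num), h.trans_lt (by norm_num)⟩

/-! ## §4 NON-VACUITY: the sharp END window `εw♯ = R²∕(9b + 3R + 1)` meets the `< 1` form and is positive -/

/-- **THE BOUND OF §2 IS THE ACTUAL SIZE, NOT SLACK**: the chosen window `εw♯ = R²∕(18·½·b + 3R + 1) = R²∕(9b + 3R + 1)`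
(f3 `window_ok_M` at `M_Q = ½`) is positive and meets the window condition in its `< 1` form — about twice the plug's
`r`-ceiling `R²∕(18b)` of §2. [folklore] -/
theorem window_nonvacuous_sharp {R b : ℝ} (hR : 0 < R) (hb : 0 ≤ b) :
    9 * Mq R (1 / 2) * b * (R ^ 2 / (18 * (1 / 2) * b + 3 * R + 1)) < 1 ∧ 0 < R ^ 2 / (18 * (1 / 2) * b + 3 * R + 1) ∧
      R ^ 2 / (18 * (1 / 2) * b + 3 * R + 1) = R ^ 2 / (9 * b + 3 * R + 1) :=
  ⟨(window_ok_M hR hb (by norm_num)).1, by positivity, by norm_num⟩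

/-! ## §5 The sharp END's own chart window: `εw♯ ≤ R♯²∕(9·(Lᵈ∕L))`; `< 5.43·10⁻⁷` on `T⁴` at `L = 2` -/

/-- **THE SHARP (LR)_j END's CHART WINDOW** `εw♯ = R♯²∕(9b + 3R♯ + 1)` is at most `R♯²∕(9·(Lᵈ∕L))` (`b ≥ Lᵈ∕L`). [folklore] -/
theorem chartWindow_sharp_le {L d : ℕ} (hL : 0 < L) {ε : ℝ} (hε : 0 ≤ ε) (hbud : (L : ℝ) ^ d / L * (24 * ε) < 1) :
    (1 / (16 * ((d : ℝ) + 1) * L)) ^ 2 /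
        (18 * (1 / 2) * (((L : ℝ) ^ d / L) / (1 - (L : ℝ) ^ d / L * (24 * ε))) + 3 * (1 / (16 * ((d : ℝ) + 1) * L)) + 1)
      ≤ (1 / (16 * ((d : ℝ) + 1) * L)) ^ 2 / (9 * ((L : ℝ) ^ d / L)) := by
  have hLr : (0 : ℝ) < L := by exact_mod_cast hL
  have hR : (0 : ℝ) < 1 / (16 * ((d : ℝ) + 1) * L) := by positivity
  have ha : 0 < (L : ℝ) ^ d / L := by positivity
  have hbge := b_ge (d := d) hL hε hbud
  exact div_le_div_of_nonneg_left (by positivity) (by positivity) (by nlinarith)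

/-- **ON `T⁴` AT `L = 2`**: the sharp END's chart window is `< 5.43·10⁻⁷` (exactly `≤ 1∕1 843 200 = R♯²∕72`). [folklore] -/
theorem chartWindow_sharp_lt_L2 {ε : ℝ} (hε : 0 ≤ ε) (hbud : ((2 : ℕ) : ℝ) ^ 4 / (2 : ℕ) * (24 * ε) < 1) :
    (1 / (16 * ((4 : ℕ) + 1 : ℝ) * (2 : ℕ))) ^ 2 /
        (18 * (1 / 2) * ((((2 : ℕ) : ℝ) ^ 4 / (2 : ℕ)) / (1 - ((2 : ℕ) : ℝ) ^ 4 / (2 : ℕ) * (24 * ε))) +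
          3 * (1 / (16 * ((4 : ℕ) + 1 : ℝ) * (2 : ℕ))) + 1) < 543 / 10 ^ 9 := by
  have h := chartWindow_sharp_le (d := 4) (L := 2) (by norm_num) hε hbud
  refine h.trans_lt ?_
  norm_num

/-! ## §6 DECIMALS FOR WALL §2b ROW `S`: `R♯`, `Mq R♯ ½`, `εw♯(ε = 0)` at `d = 4`, `L = 2, 3`; the gains over S97

THE LINE TO QUOTE.  Sharp W-d window (S100: S52∕S91's ENDs and S91 f3's plug re-fired at `(R♯, ½)` — f3 ∘ f2, f5; `d = 4`): **L = 2**: `R♯ = 1∕160 =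
6.25·10⁻³` (S97: `1∕28160`), `Mq R♯ ½ = 1∕R♯² = 25 600` (S97: `1 585 971 200`), Neumann budget unchanged (`ε < 1∕192`),
`b = 8∕(1 − 192ε)`, **`εw♯ = R♯²∕(9b + 3R♯ + 1) = 1∕1 869 280 ≈ 5.350·10⁻⁷ at ε = 0`** (S97: `1∕114 982 996 480 ≈ 8.70·10⁻¹²`;
gain `61 511.9`), the plug's window `εw ≤ R♯²∕(18b) ≤ 1∕3 686 400 ≈ 2.713·10⁻⁷` (S97: `1∕228 379 852 800 ≈ 4.38·10⁻¹²`;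
gain `61 952 = 2·176²`), every slot radius `r < εw`.  **L = 3**: `R♯ = 1∕240`, `Mq R♯ ½ = 57 600`, budget `ε < 1∕648`,
`εw♯(ε = 0) = 1∕14 055 120 ≈ 7.11·10⁻⁸`, plug `≤ 1∕27 993 600 ≈ 3.57·10⁻⁸`.  (Kernel: the theorems below; second
engine: exact rationals on the journal.) -/

/-- `R♯ = 1∕160` on `T⁴` at `L = 2`; `= 1∕240` at `L = 3`. [folklore] -/
theorem Rsharp_T4 : (1 : ℝ) / (16 * ((4 : ℕ) + 1 : ℝ) * (2 : ℕ)) = 1 / 160 ∧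
    (1 : ℝ) / (16 * ((4 : ℕ) + 1 : ℝ) * (3 : ℕ)) = 1 / 240 := by
  constructor <;> norm_num

/-- `Mq R♯ ½ = 1∕R♯² = 25 600` at `L = 2`; `= 57 600` at `L = 3`. [folklore] -/
theorem Mq_sharp_T4 : Mq (1 / 160) (1 / 2) = 25600 ∧ Mq (1 / 240) (1 / 2) = 57600 := by
  constructor <;> (rw [Mq_half]; norm_num)

/-- **THE SHARP END's WINDOW AT `ε = 0`, `d = 4`, `L = 2`: `εw♯ = 1∕1 869 280`, `5.349·10⁻⁷ < εw♯ < 5.350·10⁻⁷`.** [folklore] -/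
theorem chartWindow_sharp_T4_L2_zero :
    (1 / (16 * ((4 : ℕ) + 1 : ℝ) * (2 : ℕ))) ^ 2 /
        (18 * (1 / 2) * ((((2 : ℕ) : ℝ) ^ 4 / (2 : ℕ)) / (1 - ((2 : ℕ) : ℝ) ^ 4 / (2 : ℕ) * (24 * 0))) +
          3 * (1 / (16 * ((4 : ℕ) + 1 : ℝ) * (2 : ℕ))) + 1) = 1 / 1869280 ∧
      (5349 : ℝ) / 10 ^ 10 < 1 / 1869280 ∧ (1 : ℝ) / 1869280 < 5350 / 10 ^ 10 := by
  refine ⟨?_, by norm_num, by norm_num⟩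
  norm_num

/-- **THE SHARP END's WINDOW AT `ε = 0`, `d = 4`, `L = 3`: `εw♯ = 1∕14 055 120`, `7.11·10⁻⁸ < εw♯ < 7.12·10⁻⁸`.** [folklore] -/
theorem chartWindow_sharp_T4_L3_zero :
    (1 / (16 * ((4 : ℕ) + 1 : ℝ) * (3 : ℕ))) ^ 2 /
        (18 * (1 / 2) * ((((3 : ℕ) : ℝ) ^ 4 / (3 : ℕ)) / (1 - ((3 : ℕ) : ℝ) ^ 4 / (3 : ℕ) * (24 * 0))) +
          3 * (1 / (16 * ((4 : ℕ) + 1 : ℝ) * (3 : ℕ))) + 1) = 1 / 14055120 ∧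
      (711 : ℝ) / 10 ^ 10 < 1 / 14055120 ∧ (1 : ℝ) / 14055120 < 712 / 10 ^ 10 := by
  refine ⟨?_, by norm_num, by norm_num⟩
  norm_num

/-- **THE GAINS OVER S97** (`d = 4`, `L = 2`, `ε = 0`): END window `114 982 996 480∕1 869 280 ∈ (61 511, 61 512)`; plug
ceiling `228 379 852 800∕3 686 400 = 61 952 = 2·176²` (the radius factor `2816∕16 = 176` squared, times `M = 1 → ½`).
[folklore] -/
theorem gain_T4_L2 : (61511 : ℝ) < (1 / 1869280 : ℝ) / (1 / 114982996480) ∧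
    (1 / 1869280 : ℝ) / (1 / 114982996480) < 61512 ∧
    (1 / 3686400 : ℝ) / (1 / 228379852800) = 61952 ∧ (2 : ℝ) * (2816 / 16) ^ 2 = 61952 := by
  refine ⟨by norm_num, by norm_num, by norm_num, by norm_num⟩

end Summit.QuantumFields.BalabanUV.T4Continuum.ShellMeasureLinearizedWindowNumbersSharp
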